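import Literature.RepresentationTheory.BorelWallach2000.U11PrincipalSeriesCompositionSeries
import Literature.Algebra.Module.LoewySeries
import HarnessLib

/-!
# Socle, radical and Loewy length of the principal series `P(s, λ)` of `U(1,1)`: `soc P = W(a₂) ≅ D`, `rad P = W(a₁)`, `P / rad P ≅ D̄`,
# Loewy length `3` (two zeros), `2` (double zero), `1` (irreducible) (Bump Thm. 2.5.3–2.5.4; Krause, Conventions)

Family `hodge`, lane `lit-hodgefound` (foundations library; seat `lit-hodgefound-p39`, generation 33, row g33-#15); topic
`RepresentationTheory/BorelWallach2000`, namespace `…BorelWallach2000.U11PS` (continued).  Sequel of `U11PrincipalSeriesCompositionSeries`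
(`submodule_cases : Sub_R(P(s, λ)) = {0, W(a₂), W(a₁), P}` for the zeros `a₁ ≤ a₂`, `a₁ + a₂ = s + 1`, of `lc s λ`; `bot_covBy_upperR`,
`upperR_covBy_top`, `isFiniteLength`) and of the generic g33-#4/#12/#14 files (`SocleRadical.socle`, Mathlib's `Module.jacobson`,
`radicalSeries`, `loewyLength`).  «`π(s₁, s₂, ε)` is reducible, although it does not split» (Bump) — here in Loewy-theoretic form:
`P(s, λ)` is UNISERIAL with unique irreducible submodule `soc P = W(a₂)` (`≅ D_{(a₂, s−a₂)}`) and unique irreducible quotient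
`P / rad P = P / W(a₁)` (`≅ D̄_{(1−a₁, a₁−1−s)}`); its radical series is `P ⊋ W(a₁) ⊋ W(a₂) ⊋ 0` (two zeros `a₁ < a₂`), so the Loewy length
is `3`, resp. `P ⊋ W(a₀) ⊋ 0` and Loewy length `2` at a double zero, and `1` for irreducible `P(s, λ)`.
Theorems only (0 definitions), 0 `sorry`, no named fact (net debt 0, D-0026).

## The sources

D. Bump, *Automorphic Forms and Representations* (1997) [Bump1997, Thm. 2.5.3 (ii)–(iii), Thm. 2.5.4 (ii), p. 200]; H. Krause (2021)
[Krause2021, Conventions «Socle», «Radical»]; A. J. Berrick, M. E. Keating (2000) [BerrickKeating2000, §4.1.13]; A. W. Knapp, D. A. Vogan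
(1995) [KnappVogan1995, App. A §3].

## What is formalised (`R = GKRing G11`, `P = psMod s λ`, zeros `a₁ ≤ a₂` of `lc s λ` with `a₁ + a₂ = s + 1`)

* §1 `isAtom_iff_eq_upperR`, **`socle_psMod : soc P = W(a₂)`**, `isSimpleModule_socle_psMod`; `isCoatom_iff_eq_upperR`,
  **`jacobson_psMod : rad P = W(a₁)`**, `isSimpleModule_top_psMod` (unique irreducible submodule / quotient).
* §2 the radical series: `radicalSeries_psMod_one = W(a₁)`, **`radicalSeries_psMod_two = W(a₂)`** (`a₁ < a₂`; `= 0` at a double zero),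
  `radicalSeries_psMod_three = 0`.
* §3 **`loewyLength_psMod = 3`** (`a₁ < a₂`), **`loewyLength_psMod₂ = 2`** (double zero), `loewyLength_psMod_of_irreducible = 1`;
  `not_isSemisimpleModule_psMod` («does not split»).

## Mathlib / Literature search

Tree: `U11PS.submodule_cases`, `bot_covBy_upperR`, `upperR_covBy_top`, `upperR_lt_upperR_iff`, `upperR_le_upperR_iff`, `upperR_ne_bot/_ne_top`,
`bot_lt_upperR`, `upperR_lt_top`, `isFiniteLength`, `isSimpleModule_iff`; generic g33-#4 `socle_le_iff`, `le_socle_of_isAtom`,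
`jacobson_eq_sInf_isCoatom`, `jacobson_eq_bot_of_isSimpleModule`, `socle_eq_top_iff`; g33-#12 `range_le_socle_of_isSemisimpleModule`;
g33-#14 `radicalSeries*`, `loewyLength*`; Mathlib `isSimpleModule_iff_isAtom`, `isSimpleModule_iff_isCoatom`, `IsArtinian.isSemisimpleModule_iff_jacobson`.
`rg -n 'socle_psMod|jacobson_psMod|loewy' BorelWallach2000` → nothing before this file.

## References

* D. Bump, *Automorphic Forms and Representations*, Cambridge Stud. Adv. Math. 55 (1997), §2.5 Thm. 2.5.3, Thm. 2.5.4. [Bump1997]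
* H. Krause, *Homological Theory of Representations* (2021), Conventions. [Krause2021]
* A. J. Berrick, M. E. Keating, *An Introduction to Rings and Modules* (2000), §4.1.13. [BerrickKeating2000]
* A. W. Knapp, D. A. Vogan, *Cohomological Induction and Unitary Representations* (1995), App. A §3. [KnappVogan1995]
-/

noncomputable section

open scoped Matrix ComplexConjugate

namespace Literature.RepresentationTheory.BorelWallach2000

open Literature.Algebra.Module
open Literature.NumberTheory.Automorphic
open Literature.RepresentationTheory.KonnoKonno2007 Literature.RepresentationTheory.KonnoKonno2007.RealDualPair
open Literature.RepresentationTheory.KonnoKonno2007.RealDualPair.UForm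
open U11HolDS

-- Mathlib idiom (as in `GKModules`, `GKModuleRing`): commutator bracket on `Module.End`
attribute [local instance 100] LieRing.ofAssociativeRing

-- carriers `↥W`, `M ⧸ W` over `GKRing G11` (as in `GKModuleRing` §7–§8)
set_option maxSynthPendingDepth 4

namespace U11PS

section Loewy

variable {s : ℤ} {lam : ℂ}

/-- `P(s, λ)` is Artinian and Noetherian over the operator ring (finite length). [cite: KnappVogan1995, App. A §3 (A.17)] -/
theorem isArtinian_psMod : IsArtinian (GKRing G11) (psMod s lam) :=
  (isFiniteLength_iff_isNoetherian_isArtinian.mp (isFiniteLength (s := s) (lam := lam))).2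

/-- (Noetherian.) [cite: KnappVogan1995, App. A §3 (A.17)] -/
theorem isNoetherian_psMod : IsNoetherian (GKRing G11) (psMod s lam) :=
  (isFiniteLength_iff_isNoetherian_isArtinian.mp (isFiniteLength (s := s) (lam := lam))).1

/-! ## §1 The socle and the radical of a reducible `P(s, λ)` -/

/-- The minimal submodules of a reducible `P(s, λ)`: **the only atom of `Sub_R(P)` is `W(a₂)`** (`a₂` the larger zero).
[cite: Bump1997, Thm. 2.5.3 (ii)–(iii), Thm. 2.5.4 (ii)] -/
theorem isAtom_iff_eq_upperR {a₁ a₂ : ℤ} (h₁ : lc s lam a₁ = 0) (h₂ : lc s lam a₂ = 0) (h₁₂ : a₁ + a₂ = s + 1) (hle : a₁ ≤ a₂)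
    (W : Submodule (GKRing G11) (psMod s lam)) : IsAtom W ↔ W = upperR h₂ := by
  constructor
  · intro hW
    rcases submodule_cases h₁ h₂ h₁₂ W with rfl | rfl | rfl | rfl
    · exact absurd rfl hW.1
    · rfl
    · -- `W(a₁)` is an atom only if `W(a₂) = W(a₁)`
      by_contra hne
      have hlt : upperR h₂ < upperR h₁ :=
        lt_of_le_of_ne ((upperR_le_upperR_iff h₂ h₁).mpr hle) (Ne.symm hne)
      exact upperR_ne_bot h₂ (hW.2 _ hlt)
    · exact absurd (hW.2 _ (upperR_lt_top h₂)) (upperR_ne_bot h₂)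
  · rintro rfl
    exact bot_covBy_iff.mp (bot_covBy_upperR h₁ h₂ h₁₂ hle)

/-- **`soc P(s, λ) = W(a₂)`**: the unique irreducible submodule (`≅ D_{(a₂, s−a₂)}`, Bump's `ℌ₊`). [cite: Bump1997, Thm. 2.5.3 (ii)–(iii), Thm. 2.5.4 (ii)]
[cite: Krause2021, Conventions «Socle»] -/
theorem socle_psMod {a₁ a₂ : ℤ} (h₁ : lc s lam a₁ = 0) (h₂ : lc s lam a₂ = 0) (h₁₂ : a₁ + a₂ = s + 1) (hle : a₁ ≤ a₂) :
    SocleRadical.socle (GKRing G11) (psMod s lam) = upperR h₂ := by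
  refine le_antisymm ?_ (SocleRadical.le_socle_of_isAtom ((isAtom_iff_eq_upperR h₁ h₂ h₁₂ hle _).mpr rfl))
  rw [SocleRadical.socle_le_iff]
  intro m hm
  rw [isSimpleModule_iff_isAtom, isAtom_iff_eq_upperR h₁ h₂ h₁₂ hle] at hm
  exact hm.le

/-- The socle of a reducible `P(s, λ)` is irreducible. [cite: Bump1997, Thm. 2.5.3 (ii)–(iii)] [cite: Krause2021, Conventions «Socle»] -/
theorem isSimpleModule_socle_psMod {a₁ a₂ : ℤ} (h₁ : lc s lam a₁ = 0) (h₂ : lc s lam a₂ = 0) (h₁₂ : a₁ + a₂ = s + 1)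
    (hle : a₁ ≤ a₂) : IsSimpleModule (GKRing G11) ↥(SocleRadical.socle (GKRing G11) (psMod s lam)) := by
  rw [isSimpleModule_iff_isAtom, socle_psMod h₁ h₂ h₁₂ hle]
  exact bot_covBy_iff.mp (bot_covBy_upperR h₁ h₂ h₁₂ hle)

/-- The maximal submodules of a reducible `P(s, λ)`: **the only coatom of `Sub_R(P)` is `W(a₁)`** (`a₁` the smaller zero).
[cite: Bump1997, Thm. 2.5.3 (ii)–(iii), Thm. 2.5.4 (ii)] -/
theorem isCoatom_iff_eq_upperR {a₁ a₂ : ℤ} (h₁ : lc s lam a₁ = 0) (h₂ : lc s lam a₂ = 0) (h₁₂ : a₁ + a₂ = s + 1) (hle : a₁ ≤ a₂)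
    (W : Submodule (GKRing G11) (psMod s lam)) : IsCoatom W ↔ W = upperR h₁ := by
  constructor
  · intro hW
    rcases submodule_cases h₁ h₂ h₁₂ W with rfl | rfl | rfl | rfl
    · exact absurd (hW.2 _ (bot_lt_upperR h₁)) (upperR_ne_top h₁)
    · by_contra hne
      have hlt : upperR h₂ < upperR h₁ := lt_of_le_of_ne ((upperR_le_upperR_iff h₂ h₁).mpr hle) hne
      exact upperR_ne_top h₁ (hW.2 _ hlt)
    · rfl
    · exact absurd rfl hW.1
  · rintro rfl
    exact covBy_top_iff.mp (upperR_covBy_top h₁ h₂ h₁₂ hle)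

/-- **`rad P(s, λ) = W(a₁)`**: the unique maximal submodule (quotient `≅ D̄_{(1−a₁, a₁−1−s)}`, Bump's `ℌ₋`).
[cite: Bump1997, Thm. 2.5.3 (ii)–(iii), Thm. 2.5.4 (ii)] [cite: Krause2021, Conventions «Radical»] -/
theorem jacobson_psMod {a₁ a₂ : ℤ} (h₁ : lc s lam a₁ = 0) (h₂ : lc s lam a₂ = 0) (h₁₂ : a₁ + a₂ = s + 1) (hle : a₁ ≤ a₂) :
    Module.jacobson (GKRing G11) (psMod s lam) = upperR h₁ := by
  rw [SocleRadical.jacobson_eq_sInf_isCoatom]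
  have hset : {m : Submodule (GKRing G11) (psMod s lam) | IsCoatom m} = {upperR h₁} := by
    ext m
    rw [Set.mem_setOf_eq, Set.mem_singleton_iff, isCoatom_iff_eq_upperR h₁ h₂ h₁₂ hle]
  rw [hset, sInf_singleton]

/-- The top `P / rad P` of a reducible `P(s, λ)` is irreducible. [cite: Bump1997, Thm. 2.5.3 (ii)–(iii)] [cite: Krause2021, Conventions «Radical»] -/
theorem isSimpleModule_top_psMod {a₁ a₂ : ℤ} (h₁ : lc s lam a₁ = 0) (h₂ : lc s lam a₂ = 0) (h₁₂ : a₁ + a₂ = s + 1)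
    (hle : a₁ ≤ a₂) : IsSimpleModule (GKRing G11) (psMod s lam ⧸ Module.jacobson (GKRing G11) (psMod s lam)) := by
  rw [isSimpleModule_iff_isCoatom, jacobson_psMod h₁ h₂ h₁₂ hle]
  exact covBy_top_iff.mp (upperR_covBy_top h₁ h₂ h₁₂ hle)

/-- **A reducible `P(s, λ)` is not semisimple** («reducible, although it does not split»): `rad P = W(a₁) ≠ 0`.
[cite: Bump1997, Thm. 2.5.4 (ii), p. 200] -/
theorem not_isSemisimpleModule_psMod {a₁ a₂ : ℤ} (h₁ : lc s lam a₁ = 0) (h₂ : lc s lam a₂ = 0) (h₁₂ : a₁ + a₂ = s + 1)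
    (hle : a₁ ≤ a₂) : ¬ IsSemisimpleModule (GKRing G11) (psMod s lam) := by
  intro hss
  have h0 := SocleRadical.jacobson_eq_bot_of_isSemisimpleModule (GKRing G11) (psMod s lam)
  rw [jacobson_psMod h₁ h₂ h₁₂ hle] at h0
  exact upperR_ne_bot h₁ h0

/-! ## §2 The radical series `P ⊋ W(a₁) ⊋ W(a₂) ⊋ 0` -/

/-- Plumbing (any ring): the next radical once the previous one is identified. [cite: Krause2021, Conventions «Radical»] -/
private theorem radicalSeries_succ_of_eq {R : Type*} [Ring R] {M : Type*} [AddCommGroup M] [Module R M] {n : ℕ}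
    {N : Submodule R M} (h : SocleRadical.radicalSeries R M n = N) :
    SocleRadical.radicalSeries R M (n + 1) = (Module.jacobson R ↥N).map N.subtype := by
  subst h
  rfl

/-- `rad¹ P = W(a₁)`. [cite: Bump1997, Thm. 2.5.3 (ii)–(iii)] [cite: Krause2021, Conventions «Radical»] -/
theorem radicalSeries_psMod_one {a₁ a₂ : ℤ} (h₁ : lc s lam a₁ = 0) (h₂ : lc s lam a₂ = 0) (h₁₂ : a₁ + a₂ = s + 1) (hle : a₁ ≤ a₂) :
    SocleRadical.radicalSeries (GKRing G11) (psMod s lam) 1 = upperR h₁ := by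
  rw [SocleRadical.radicalSeries_one, jacobson_psMod h₁ h₂ h₁₂ hle]

/-- The radical of the submodule `W(a₁)`, read in `P`: it is `W(a₂)` for `a₁ < a₂` — `W(a₁)` is not semisimple (its socle is `W(a₂) ≠ W(a₁)`),
and `rad W(a₁) ∈ {0, W(a₂), W(a₁)}` with `rad W(a₁) ≠ W(a₁)`. [cite: Bump1997, Thm. 2.5.3 (ii)–(iii)] [cite: Krause2021, Conventions «Radical»] -/
theorem map_jacobson_upperR {a₁ a₂ : ℤ} (h₁ : lc s lam a₁ = 0) (h₂ : lc s lam a₂ = 0) (h₁₂ : a₁ + a₂ = s + 1) (hlt : a₁ < a₂) :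
    (Module.jacobson (GKRing G11) ↥(upperR h₁)).map (upperR h₁).subtype = upperR h₂ := by
  haveI := isArtinian_psMod (s := s) (lam := lam)
  haveI := isNoetherian_psMod (s := s) (lam := lam)
  set K := (Module.jacobson (GKRing G11) ↥(upperR h₁)).map (upperR h₁).subtype with hK
  have hKle : K ≤ upperR h₁ := Submodule.map_subtype_le _ _
  rcases submodule_cases h₁ h₂ h₁₂ K with h0 | h0 | h0 | h0
  · -- `rad W(a₁) = 0` would make `W(a₁)` semisimple, hence inside `soc P = W(a₂) < W(a₁)`
    exfalso
    have hj : Module.jacobson (GKRing G11) ↥(upperR h₁) = ⊥ := by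
      have := (Submodule.map_injective_of_injective (Submodule.subtype_injective (upperR h₁))).eq_iff
        (a := Module.jacobson (GKRing G11) ↥(upperR h₁)) (b := ⊥)
      rw [Submodule.map_bot] at this
      exact this.mp h0
    haveI : IsSemisimpleModule (GKRing G11) ↥(upperR h₁) := (IsArtinian.isSemisimpleModule_iff_jacobson _ _).mpr hj
    have hle : upperR h₁ ≤ SocleRadical.socle (GKRing G11) (psMod s lam) := by
      have := SocleRadical.range_le_socle_of_isSemisimpleModule (upperR h₁).subtype
      rwa [Submodule.range_subtype] at this
    rw [socle_psMod h₁ h₂ h₁₂ hlt.le, upperR_le_upperR_iff] at hle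
    exact absurd hle (not_le.mpr hlt)
  · exact h0
  · -- `rad W(a₁) = W(a₁)` is impossible (`W(a₁) ≠ 0` is finitely generated)
    exfalso
    haveI : Nontrivial ↥(upperR h₁) := Submodule.nontrivial_iff_ne_bot.mpr (upperR_ne_bot h₁)
    apply SocleRadical.jacobson_ne_top (GKRing G11) ↥(upperR h₁)
    apply Submodule.map_injective_of_injective (Submodule.subtype_injective (upperR h₁))
    rw [Submodule.map_top, Submodule.range_subtype]
    exact h0
  · rw [h0, top_le_iff] at hKle
    exact absurd hKle (upperR_ne_top h₁)

/-- **`rad² P = W(a₂)`** for two distinct zeros `a₁ < a₂`. [cite: Bump1997, Thm. 2.5.3 (ii)–(iii)] [cite: Krause2021, Conventions «Radical»] -/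
theorem radicalSeries_psMod_two {a₁ a₂ : ℤ} (h₁ : lc s lam a₁ = 0) (h₂ : lc s lam a₂ = 0) (h₁₂ : a₁ + a₂ = s + 1) (hlt : a₁ < a₂) :
    SocleRadical.radicalSeries (GKRing G11) (psMod s lam) 2 = upperR h₂ := by
  rw [radicalSeries_succ_of_eq (radicalSeries_psMod_one h₁ h₂ h₁₂ hlt.le), map_jacobson_upperR h₁ h₂ h₁₂ hlt]

/-- The radical of the simple submodule `W(a₂)` vanishes. [cite: Bump1997, Thm. 2.5.3 (ii)] [cite: Krause2021, Conventions «Radical»] -/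
theorem map_jacobson_upperR_eq_bot {a₁ a₂ : ℤ} (h₁ : lc s lam a₁ = 0) (h₂ : lc s lam a₂ = 0) (h₁₂ : a₁ + a₂ = s + 1) (hle : a₁ ≤ a₂) :
    (Module.jacobson (GKRing G11) ↥(upperR h₂)).map (upperR h₂).subtype = ⊥ := by
  haveI : IsSimpleModule (GKRing G11) ↥(upperR h₂) :=
    isSimpleModule_iff_isAtom.mpr (bot_covBy_iff.mp (bot_covBy_upperR h₁ h₂ h₁₂ hle))
  rw [SocleRadical.jacobson_eq_bot_of_isSimpleModule, Submodule.map_bot]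

/-- **`rad³ P = 0`** for two distinct zeros. [cite: Bump1997, Thm. 2.5.3 (ii)–(iii)] [cite: Krause2021, Conventions «Radical»] -/
theorem radicalSeries_psMod_three {a₁ a₂ : ℤ} (h₁ : lc s lam a₁ = 0) (h₂ : lc s lam a₂ = 0) (h₁₂ : a₁ + a₂ = s + 1) (hlt : a₁ < a₂) :
    SocleRadical.radicalSeries (GKRing G11) (psMod s lam) 3 = ⊥ := by
  rw [radicalSeries_succ_of_eq (radicalSeries_psMod_two h₁ h₂ h₁₂ hlt), map_jacobson_upperR_eq_bot h₁ h₂ h₁₂ hlt.le]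

/-- **`rad² P = 0` at a double zero** (`W(a₀)` is simple). [cite: Bump1997, Thm. 2.5.4 (ii)] [cite: Krause2021, Conventions «Radical»] -/
theorem radicalSeries_psMod_two₂ {a₀ : ℤ} (h : lc s lam a₀ = 0) (h2 : 2 * a₀ = s + 1) :
    SocleRadical.radicalSeries (GKRing G11) (psMod s lam) 2 = ⊥ := by
  rw [radicalSeries_succ_of_eq (radicalSeries_psMod_one h h (by omega) le_rfl), map_jacobson_upperR_eq_bot h h (by omega) le_rfl]

/-! ## §3 The Loewy length -/

/-- **The Loewy length of `P(s, λ)` with two distinct zeros is `3`** (`P ⊋ W(a₁) ⊋ W(a₂) ⊋ 0`). [cite: Bump1997, Thm. 2.5.3 (ii)–(iii)]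
[cite: Krause2021, Conventions «Radical»] -/
theorem loewyLength_psMod {a₁ a₂ : ℤ} (h₁ : lc s lam a₁ = 0) (h₂ : lc s lam a₂ = 0) (h₁₂ : a₁ + a₂ = s + 1) (hlt : a₁ < a₂) :
    SocleRadical.loewyLength (GKRing G11) (psMod s lam) = 3 := by
  haveI := isArtinian_psMod (s := s) (lam := lam)
  haveI := isNoetherian_psMod (s := s) (lam := lam)
  refine le_antisymm ?_ ?_
  · exact SocleRadical.radicalSeries_eq_bot_iff_loewyLength_le.mp (radicalSeries_psMod_three h₁ h₂ h₁₂ hlt)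
  · by_contra hlt3
    have h2 : SocleRadical.loewyLength (GKRing G11) (psMod s lam) ≤ 2 := by omega
    have h0 := SocleRadical.radicalSeries_eq_bot_iff_loewyLength_le.mpr h2
    rw [radicalSeries_psMod_two h₁ h₂ h₁₂ hlt] at h0
    exact upperR_ne_bot h₂ h0

/-- **The Loewy length of `P(s, λ)` at a double zero is `2`** (`P ⊋ W(a₀) ⊋ 0`). [cite: Bump1997, Thm. 2.5.4 (ii)] [cite: Krause2021, Conventions «Radical»] -/
theorem loewyLength_psMod₂ {a₀ : ℤ} (h : lc s lam a₀ = 0) (h2 : 2 * a₀ = s + 1) :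
    SocleRadical.loewyLength (GKRing G11) (psMod s lam) = 2 := by
  haveI := isArtinian_psMod (s := s) (lam := lam)
  haveI := isNoetherian_psMod (s := s) (lam := lam)
  refine le_antisymm ?_ ?_
  · exact SocleRadical.radicalSeries_eq_bot_iff_loewyLength_le.mp (radicalSeries_psMod_two₂ h h2)
  · by_contra hlt2
    have h1 : SocleRadical.loewyLength (GKRing G11) (psMod s lam) ≤ 1 := by omega
    have h0 := SocleRadical.radicalSeries_eq_bot_iff_loewyLength_le.mpr h1
    rw [radicalSeries_psMod_one h h (by omega) le_rfl] at h0
    exact upperR_ne_bot h h0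

/-- The Loewy length of an IRREDUCIBLE `P(s, λ)` is `1`. [cite: Bump1997, Thm. 2.5.3 (i)] [cite: Krause2021, Conventions «Radical»] -/
theorem loewyLength_psMod_of_irreducible (hirr : ∀ a : ℤ, lc s lam a ≠ 0) :
    SocleRadical.loewyLength (GKRing G11) (psMod s lam) = 1 := by
  haveI := isArtinian_psMod (s := s) (lam := lam)
  haveI := isNoetherian_psMod (s := s) (lam := lam)
  haveI : IsSimpleModule (GKRing G11) (psMod s lam) := isSimpleModule_iff.mpr hirr
  refine le_antisymm (SocleRadical.loewyLength_le_one_iff.mpr inferInstance) ?_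
  rw [Nat.one_le_iff_ne_zero, Ne, SocleRadical.loewyLength_eq_zero_iff, not_subsingleton_iff_nontrivial]
  exact IsSimpleModule.nontrivial (GKRing G11) (psMod s lam)

/-- The socle series read off: `soc³ P = P` for two distinct zeros (Loewy length = height, g33-#14). [cite: Krause2021, Conventions «Socle»] -/
theorem socleSeries_psMod_three {a₁ a₂ : ℤ} (h₁ : lc s lam a₁ = 0) (h₂ : lc s lam a₂ = 0) (h₁₂ : a₁ + a₂ = s + 1) (hlt : a₁ < a₂) :
    SocleRadical.socleSeries (GKRing G11) (psMod s lam) 3 = ⊤ := by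
  haveI := isArtinian_psMod (s := s) (lam := lam)
  exact SocleRadical.socleSeries_eq_top_of_radicalSeries_eq_bot (radicalSeries_psMod_three h₁ h₂ h₁₂ hlt)

/-- … and `soc¹ P = W(a₂)`. [cite: Krause2021, Conventions «Socle»] [cite: Bump1997, Thm. 2.5.3 (ii)] -/
theorem socleSeries_psMod_one {a₁ a₂ : ℤ} (h₁ : lc s lam a₁ = 0) (h₂ : lc s lam a₂ = 0) (h₁₂ : a₁ + a₂ = s + 1) (hle : a₁ ≤ a₂) :
    SocleRadical.socleSeries (GKRing G11) (psMod s lam) 1 = upperR h₂ := by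
  rw [SocleRadical.socleSeries_one, socle_psMod h₁ h₂ h₁₂ hle]

end Loewy

end U11PS

end Literature.RepresentationTheory.BorelWallach2000
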